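import Summits.ValiantsHypothesis.ValiantsHypothesis.Theorems.LangWeilTransferTameResolutionEliminantPrelims

/-!
# LangWeilTransfer, support item `TameResolution` (stmt-ValiantsHypothesis-6378) — the relative
# eliminant identity for a SINGLE fibre coordinate (input of the Noether loop)

Route `LangWeilTransfer` of `ValiantsHypothesis` (conditional route; honest framing: bookkeeping,
nothing here bears on VP ≠ VNP). Setting ((R) of the architecture note of val-lit-p6 g9): a
system `S_1, …, S_t ∈ ℤ[T_1..T_r][X_1..X_n]` (the original equations in coordinates split into
parameters `T` and fibre variables `X`), and a ring homomorphism `φ : ℤ[T][X] → F₀` to a field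
(evaluation at the generic point `(T̄, ξ)` of a component `V(𝔭)`, `𝔭 = ker φ`) such that
`ℤ[T] → F₀` is injective (`T̄` algebraically independent), every `ξ_j = φ(X_j)` is algebraic over
`ℤ[T̄]`, the `S_k` vanish at the point, and `ker φ` is the only prime between `(S)` and `ker φ`
(minimality of the component). Over the universal coefficient ring
`R_u = ℤ[T, α_{ik}, Λ_j]` form the square system `F_i = Σ_k α_{ik} S_k`, the generic linear form
`u = Σ_j Λ_j X_j`, and `Q = sLead (pertCharpoly (d+1) F u k₀) ∈ R_u[U]` (Canny's generalised
characteristic polynomial, tree `PerturbedCharpoly.lean`).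

* `eliminant_identity_coord` — the variant of `eliminant_identity` (same setting, same proof) with
  the generic linear form replaced by a single fibre coordinate `u = X_j`: over
  `R_u' = ℤ[T, α_{ik}]`, `Q_j = sLead (pertCharpoly (d+1) F X_j k₀)` satisfies
  `Q_j(T̄, α, ξ_j) = 0` identically in `F₀[α]` — an algebraic equation for the coordinate `ξ_j`
  over `ℤ[T̄]` after any integer specialisation of `α` keeping `Q_j ≠ 0` (step (N) of the
  architecture note: the relations that drive the shears to Noether position).
-/

noncomputable section

open MvPolynomial
open Literature.RingTheory.Elimination

-- the summit and the problem share the name `ValiantsHypothesis` (D-0017 single-conjunct layout)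
set_option linter.dupNamespace false

namespace Summit.ValiantsHypothesis.ValiantsHypothesis.Theorems.LangWeilTransfer

section Main

variable {F₀ : Type*} [Field F₀] {r n t d : ℕ}

/-- **The relative eliminant identity for one fibre coordinate.** With `ι = T ⊔ α`, `R = ℤ[ι]`,
`F_i = Σ_k α_{ik} S_k` and `Q_j = sLead (pertCharpoly (d+1) F X_j (1 + n d + 1)) ∈ R[U]`: under
`T ↦ T̄`, `α ↦ α` into `F₀[α]` and `U ↦ ξ_j = φ(X_j)`, the leading `s`-form `Q_j` vanishes
identically. -/
theorem eliminant_identity_coord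
    (S : Fin t → MvPolynomial (Fin n) (MvPolynomial (Fin r) ℤ)) (hSd : ∀ k, (S k).totalDegree ≤ d)
    (φ : MvPolynomial (Fin n) (MvPolynomial (Fin r) ℤ) →+* F₀)
    (hT : Function.Injective (φ.comp MvPolynomial.C))
    (halg : ∀ j, ∃ P : Polynomial (MvPolynomial (Fin r) ℤ), P ≠ 0 ∧
      (P.map (φ.comp MvPolynomial.C)).eval (φ (X j)) = 0)
    (hSφ : ∀ k, φ (S k) = 0)
    (hmin : ∀ 𝔮 : Ideal (MvPolynomial (Fin n) (MvPolynomial (Fin r) ℤ)), 𝔮.IsPrime →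
      Ideal.span (Set.range S) ≤ 𝔮 → 𝔮 ≤ RingHom.ker φ → 𝔮 = RingHom.ker φ) (j₀ : Fin n) :
    let ι := Fin r ⊕ (Fin n × Fin t)
    let F : Fin n → MvPolynomial (Fin n) (MvPolynomial ι ℤ) := fun i =>
      ∑ k, C (X (Sum.inr (i, k))) *
        MvPolynomial.map (rename (Sum.inl : Fin r → ι) : MvPolynomial (Fin r) ℤ →ₐ[ℤ] MvPolynomial ι ℤ).toRingHom (S k)
    let Ψ : MvPolynomial ι ℤ →+* MvPolynomial (Fin n × Fin t) F₀ :=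
      eval₂Hom (Int.castRingHom _) (Sum.elim (fun k => C (φ (C (X k)))) (fun p => X p))
    ((sLead (pertCharpoly (d + 1) F (X j₀) (1 + n * d + 1))).map Ψ).eval (C (φ (X j₀))) = 0 := by
  intro ι F Ψ
  classical
  -- the fields `K₁ = F₀^alg`, `K₂ = K₁(α)^alg` and the transcendence basis `α`
  let K₁ := AlgebraicClosure F₀
  let L := FractionRing (MvPolynomial (Fin n × Fin t) K₁)
  let K₂ := AlgebraicClosure L
  let j₁ : F₀ →+* K₁ := algebraMap F₀ K₁
  let j₂ : K₁ →+* K₂ := algebraMap K₁ K₂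
  let jK : F₀ →+* K₂ := j₂.comp j₁
  let α : Fin n × Fin t → K₂ := fun p =>
    algebraMap L K₂ (algebraMap (MvPolynomial (Fin n × Fin t) K₁) L (X p))
  have hα : IsTranscendenceBasis K₁ α := isTranscendenceBasis_genVar K₁ (Fin n × Fin t)
  let θ₁ : MvPolynomial (Fin r) ℤ →+* K₁ := j₁.comp (φ.comp MvPolynomial.C)
  let θ₂ : MvPolynomial (Fin r) ℤ →+* K₂ := j₂.comp θ₁
  let T₂ : Fin r → K₂ := fun k => jK (φ (C (X k)))
  let ξ₂ : Fin n → K₂ := fun j => j₂ (j₁ (φ (X j)))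
  let S₂ : Fin t → MvPolynomial (Fin n) K₂ := fun k =>
    MvPolynomial.map (algebraMap K₁ K₂) (MvPolynomial.map θ₁ (S k))
  let F₂ : Fin n → MvPolynomial (Fin n) K₂ := fun i => ∑ k, C (α (i, k)) * S₂ k
  set P := pertCharpoly (d + 1) F (X j₀) (1 + n * d + 1) with hP
  -- the specialisation `ψ : R_u → K₂`
  let ψ : MvPolynomial ι ℤ →+* K₂ := eval₂Hom (Int.castRingHom K₂) (Sum.elim T₂ α)
  have hψT : ψ.comp
      (rename (Sum.inl : Fin r → ι) : MvPolynomial (Fin r) ℤ →ₐ[ℤ] MvPolynomial ι ℤ).toRingHom = θ₂ := by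
    refine MvPolynomial.ringHom_ext (fun b => ?_) (fun k => ?_)
    · simp only [ψ, AlgHom.toRingHom_eq_coe, eq_intCast, map_intCast]
    · simp only [ψ, θ₂, θ₁, j₂, jK, T₂, RingHom.comp_apply, AlgHom.toRingHom_eq_coe, RingHom.coe_coe,
        rename_X, eval₂Hom_X', Sum.elim_inl]
  have hψF : ∀ i, MvPolynomial.map ψ (F i) = F₂ i := by
    intro i
    simp only [F, F₂, S₂, map_sum, map_mul, MvPolynomial.map_C, MvPolynomial.map_map, hψT]
    refine Finset.sum_congr rfl fun k _ => ?_
    simp only [ψ, θ₂, j₂, eval₂Hom_X', Sum.elim_inr]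
  have hψu : MvPolynomial.map ψ (X j₀ : MvPolynomial (Fin n) (MvPolynomial ι ℤ)) = X j₀ := MvPolynomial.map_X _ _
  -- evaluation at the point
  have hevS : ∀ k, eval ξ₂ (S₂ k) = jK (φ (S k)) := by
    intro k
    have : (eval ξ₂).comp ((MvPolynomial.map (algebraMap K₁ K₂)).comp (MvPolynomial.map θ₁)) =
        jK.comp φ := by
      refine MvPolynomial.ringHom_ext (fun b => ?_) (fun j => ?_)
      · simp only [RingHom.comp_apply, MvPolynomial.map_C, eval_C]; rfl
      · simp only [RingHom.comp_apply, MvPolynomial.map_X, eval_X]; rfl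
    exact congrArg (fun h => h (S k)) this
  have hz : ∀ i, eval ξ₂ (F₂ i) = 0 := by
    intro i
    simp only [F₂, map_sum, map_mul, eval_C, hevS, hSφ, map_zero, mul_zero, Finset.sum_const_zero]
  -- isolation of the point
  have hmax : ∀ P' : Ideal (MvPolynomial (Fin n) K₂), P'.IsPrime → Ideal.span (Set.range F₂) ≤ P' →
      P' ≤ vanishingIdeal K₂ {ξ₂} → P' = vanishingIdeal K₂ {ξ₂} := by
    intro P' hP' hle hPξ
    haveI := hP'
    have hFP : ∀ i, F₂ i ∈ P' := fun i => hle (Ideal.subset_span ⟨i, rfl⟩)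
    have hM : P'.IsMaximal := isMaximal_of_le_point j₁ S φ hT halg hmin α hα P' hFP hPξ
    exact hM.eq_of_le (Ideal.IsMaximal.ne_top inferInstance) hPξ
  obtain ⟨g, hg, -, hfin⟩ := exists_isolating_polynomial (Ideal.span (Set.range F₂)) ξ₂ hmax
  have hfin' : ({x : Fin n → K₂ | ∀ i, eval x (F₂ i) = 0} ∩ {x | eval x g ≠ 0}).Finite := by
    refine hfin.subset ?_
    rintro x ⟨hx, hxg⟩
    refine ⟨?_, hxg⟩
    rw [zeroLocus_span]
    rintro _ ⟨i, rfl⟩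
    rw [aeval_eq_eval]; exact hx i
  -- the local limit lemma at `u = X j₀`
  have hdeg : ∀ i, (F₂ i).totalDegree < d + 1 := by
    intro i
    refine Nat.lt_succ_of_le ((totalDegree_finsetSum _ _).trans (Finset.sup_le fun k _ => ?_))
    refine (totalDegree_mul _ _).trans ?_
    rw [totalDegree_C, zero_add]
    exact (totalDegree_map_le' _ _).trans ((totalDegree_map_le' _ _).trans (hSd k))
  have huc : (X j₀ : MvPolynomial (Fin n) K₂).totalDegree + n * (d + 1 - 1) + 1 ≤ 1 + n * d + 1 := by
    rw [totalDegree_X, Nat.add_sub_cancel]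
  have hlim : ((sLead P).map ψ).eval (ξ₂ j₀) = 0 := by
    have h := eval_sLead_pertCharpoly_eq_zero_of_isolated (K := K₂) (D := d + 1) (Nat.succ_pos d)
      F₂ hdeg hz hg hfin' (X j₀) huc
    have hPc : pertCharpoly (d + 1) F₂ (X j₀) (1 + n * d + 1) = P.map (Polynomial.mapRingHom ψ) := by
      rw [hP, pertCharpoly_map, hψu]
      congr 1
      funext i
      rw [hψF]
    rw [hPc, eval_X] at h
    exact eval_map_sLead_eq_zero ψ P _ h
  -- descent to `F₀[α]`: `Θ ∘ Ψ = ψ` with `Θ` injective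
  let Θ : MvPolynomial (Fin n × Fin t) F₀ →+* K₂ := eval₂Hom jK α
  have hΘΨ : Θ.comp Ψ = ψ := by
    refine MvPolynomial.ringHom_ext (fun b => ?_) (fun v => ?_)
    · simp only [eq_intCast, map_intCast]
    · rcases v with k | p
      · simp only [Θ, Ψ, ψ, T₂, RingHom.comp_apply, eval₂Hom_X', Sum.elim_inl, eval₂Hom_C]
      · simp only [Θ, Ψ, ψ, RingHom.comp_apply, eval₂Hom_X', Sum.elim_inr]
  have hΘpt : Θ (C (φ (X j₀))) = ξ₂ j₀ := by
    simp only [Θ, ξ₂, jK, eval₂Hom_C, RingHom.comp_apply]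
  have hΘinj : Function.Injective Θ := by
    let χ : MvPolynomial (Fin n × Fin t) K₁ →+* K₂ := (aeval α : MvPolynomial (Fin n × Fin t) K₁ →ₐ[K₁] K₂).toRingHom
    have hχ : Function.Injective χ := by
      have := hα.1
      rw [algebraicIndependent_iff_injective_aeval] at this
      exact this
    have hΘ' : Θ = χ.comp (MvPolynomial.map j₁) := by
      refine MvPolynomial.ringHom_ext (fun b => ?_) (fun p => ?_)
      · simp only [Θ, χ, jK, j₂, RingHom.comp_apply, eval₂Hom_C, MvPolynomial.map_C, AlgHom.toRingHom_eq_coe,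
          RingHom.coe_coe, aeval_C]
      · simp only [Θ, χ, RingHom.comp_apply, eval₂Hom_X', MvPolynomial.map_X, AlgHom.toRingHom_eq_coe,
          RingHom.coe_coe, aeval_X]
    rw [hΘ']
    exact hχ.comp (MvPolynomial.map_injective j₁ j₁.injective)
  -- conclusion
  apply hΘinj
  rw [map_zero]
  have h1 : Θ (((sLead P).map Ψ).eval (C (φ (X j₀)))) =
      ((sLead P).map (Θ.comp Ψ)).eval (Θ (C (φ (X j₀)))) := by
    rw [Polynomial.eval_map, Polynomial.hom_eval₂, Polynomial.eval_map]
  rw [h1, hΘΨ, hΘpt]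
  exact hlim

end Main

end Summit.ValiantsHypothesis.ValiantsHypothesis.Theorems.LangWeilTransfer
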